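/- Width seat `ym-line-cbag-p1-w2` (g24), route `GlueballBandRecursion`, LINE 7b: the item-closing link for the ASIDE item
stmt-QuantumFields-23426 `ColdDoublingSmallWindow` — by name the tree theorem `Thermal.coldDoublingRecursionSmallCoupling_holds`
(LEAD `ym-line-cbag-p1` g29, p668304, with width seats w2–w5).  Sorry-free; `--workitem stmt-QuantumFields-23426`. -/
import Summits.QuantumFields.YangMills.Theses.GlueballBandRecursion
import Summits.QuantumFields.YangMills.Theorems.GlueballBandRecursionColdDoublingSmallCoupling
import HarnessLib

/-!
# Route `GlueballBandRecursion`, item `ColdDoublingSmallWindow` (stmt-QuantumFields-23426) — CLOSED by name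

`Summit.QuantumFields.YangMills.Theses.GlueballBandRecursion.ColdDoublingSmallWindow` is by definition the tree statement
`Summit.QuantumFields.YangMills.Theorems.GlueballBandRecursion.ColdDoublingRecursionSmallCoupling`: for every compact group `G` and every
faithful unitary lattice representation `r` there are `β₁ > 0`, `C > 0`, `L₀` with
`coldDefect r.ρ β L' ≤ C · (coldDefect r.ρ β L)²` for all `0 ≤ β ≤ β₁`, `L ≥ L₀`, `2L ≤ L' ≤ 4L` — the ∃-window form of the IR cell's
strong-coupling rung `Cruxes.IR.ColdPurityBridge.ColdDoublingRecursionStrongCoupling`.  It is PROVED in the tree by LINE 7b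
(`Thermal.coldDoublingRecursionSmallCoupling_holds`, file `Theorems/GlueballBandRecursionColdDoublingSmallCoupling.lean`: same-volume squaring →
volume comparison of the cold trace excess ⇐ volume-uniform `β⁴` floor + closedness-aware jet agreement of the cold log-defect density across
spatial volumes, the latter from the support expansion of the strong-coupling cluster expansion with girth-4 slab counting and spatial lifting).
This file only restates that theorem at the route declaration, so the gate can close the item by name.

HONEST FRAMING.  A RECORD-type strong-coupling statement on an existential window `[0, β₁(r)]`; it does NOT give the typed-window rung
(`0 ≤ β ≤ strongCouplingRadius r.ρ`, item `VolumeComparisonTyped` / the route's closes target), says nothing about weak coupling or the continuum,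
and the Yang–Mills mass gap (summit `YangMills`) is NOT proved or advanced by it.
-/

set_option autoImplicit false

namespace Summit.QuantumFields.YangMills.Theorems.GlueballBandRecursion

/-- **Item `ColdDoublingSmallWindow` (stmt-QuantumFields-23426) holds**: the ∃-window strong-coupling cold period-doubling contraction
`∀ compact G, ∀ r, ∃ β₁ > 0, ∃ C > 0, ∃ L₀, ∀ β ∈ [0, β₁], ∀ L ≥ L₀, ∀ L' ∈ [2L, 4L], δᶜ_β(L') ≤ C·δᶜ_β(L)²` — by name the LINE 7b theorem
`Thermal.coldDoublingRecursionSmallCoupling_holds` (LEAD `ym-line-cbag-p1` g29 + width seats).  RECORD-type, strong coupling only; the typed-window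
rung and the Yang–Mills mass gap are NOT claimed. -/
theorem coldDoublingSmallWindow_proof :
    Summit.QuantumFields.YangMills.Theses.GlueballBandRecursion.ColdDoublingSmallWindow := by
  unfold Summit.QuantumFields.YangMills.Theses.GlueballBandRecursion.ColdDoublingSmallWindow
  exact Thermal.coldDoublingRecursionSmallCoupling_holds

end Summit.QuantumFields.YangMills.Theorems.GlueballBandRecursion
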